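import Literature.AlgebraicGeometry.Resolution.AlterationsStrongAlgClosedLeaves
import Literature.AlgebraicGeometry.Resolution.AlterationsSmoothOverOpenHolds
import Literature.AlgebraicGeometry.Resolution.AlterationsNormalFormBlowupChartsHolds
import Literature.AlgebraicGeometry.Resolution.AlterationsNormalFormBlowupProofs
import HarnessLib

/-!
# De Jong 1996, 4.11–4.28 (`DeJong1996NormalProjectiveStep`) from its open leaves

Topic: `Literature/AlgebraicGeometry/Resolution`. Bookkeeping (pure composition, no new named
fact) for the named fact `DeJong1996NormalProjectiveStep` of `AlterationsInduction.lean` — de Jong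
1996, 4.11–4.28: over an algebraically closed field, Thm. 4.1 with its generically-étale clause in
dimension `≤ d` implies Thm. 4.1 with the clause for normal projective pairs `(X, Z)` of dimension
`d + 1`. That fact is an interior node of the decomposition of the printed proof already in the
tree: its glue downwards (`DeJong1996NormalProjectiveStep.of_semiStablePair`, `.of_threeBlocks`,
`.of_fibration_of_stepVI`, `.of_one_le`) and upwards (`DeJong1996InductionStep.of_step`,
`DeJong1996StrongAlgClosed.of_step`, with 4.3, 4.5 and 4.6–4.10 discharged) is proved, so its
discharge `DeJong1996NormalProjectiveStep_holds` is exactly the term below fed with the discharges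
of the leaves. `AlterationsStrongAlgClosedLeaves.lean` recorded eighteen open leaves; four of them
have since been discharged in the tree —

* `DeJong1996SmoothOverOpen_holds` (4.12 with 2.8, `AlterationsSmoothOverOpenHolds.lean`),
* `DeJong1996NodalBlowupFormalCharts_holds` (the chart computation of 4.27,
  `AlterationsNormalFormBlowupChartsFormalProofs.lean`; whence
  `DeJong1996NormalFormPairBlowupChartsOverCentre_holds`, `AlterationsNormalFormBlowupChartsHolds.lean`),
* `SNCBlowupTopStratum_holds`, whence `DeJong1996NormalCrossingsBlowup_holds` (2.4,
  `AlterationsSemiStableResolutionProofs.lean`),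
* `DeJong1996FormalNormalCrossings_holds` (4.25 (i) ⇒ normal crossings, proved WITHOUT Artin
  approximation, `AlterationsNormalFormBlowupProofs.lean`; this removes
  `Popescu1986_generalNeronDesingularization` from the trust base of Thm. 4.1),

— leaving the FOURTEEN named facts in the hypotheses of
`DeJong1996NormalProjectiveStep.of_openLeaves`: six for 4.11–4.12 (the generic projection of
Lemma 4.11 normalised at the vertex and the blow-up of the vertex; Zariski's connectedness theorem
for the Stein factorisation, finiteness-and-étaleness of its finite part, `π₁(ℙ¹) = 0` and the
connectedness of hyperplane sections of étale covers), four for 4.13–4.22 (the hyperplane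
multisection 4.13, Galois normalisation 4.16, the stable extension through the level-`ℓ` moduli
scheme 4.17/2.24, the extension of `β : 𝒞 ⇢ X` after a modification of the base 4.18–4.21/2.19) and
four for 4.23–4.28 (the node structure at closed points and in codimension two 2.23/3.3, the Claim
of 3.4, and the singular locus of the blow-up in 4.27). The same fourteen give
`DeJong1996StrongAlgClosed`, `DeJong1996Strong`, `DeJong1996StrongPerfect`, `DeJong1996Projective`
and `DeJong1996` (`DeJong1996Strong.of_openLeaves`).

## Sources

* A. J. de Jong, *Smoothness, semi-stability and alterations*, Publ. Math. IHÉS 83 (1996) 51–93: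
  Thm. 4.1 (p. 66), 4.3–4.10 (pp. 66–67), Lemma 4.11–4.22 (pp. 67–75), 4.23–4.28 (pp. 75–76),
  2.4, 2.8, 2.19, 2.23–2.24, 3.2–3.5.
-/

noncomputable section

open CategoryTheory AlgebraicGeometry

namespace Literature.AlgebraicGeometry.Resolution

universe u

open Literature.AlgebraicGeometry.Morphisms Literature.AlgebraicGeometry.FundamentalGroup

/-- **4.23–4.28 from its four open leaves** (de Jong 1996, resolution of a pair in Situation
4.23): the node structure of a semi-stable curve over a regular base degenerating along a strict
normal crossings divisor, at closed points and at the generic points of the codimension-2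
singular components (2.23/3.3), the Claim of 3.4 for one blow-up (Lemma 3.2), and the singular
locus of the blow-up of 4.26 read on completed local rings (4.27); the formal ideal of the
centre, the intersection of centres, the strict-transform closed immersion, the chart
computation of 4.27, "formal normal crossings are normal crossings" (4.25 (i)/4.28), the
strictification 2.4 and the projectivity of blow-ups are discharged in the tree.
[cite: DeJong1996, 4.23–4.28 with 3.2–3.5 and 2.4, pp. 62–65, 75–76] -/
theorem DeJong1996SemiStablePairResolution.of_openLeaves
    (hN : DeJong1996NodeLocalStructure.{u}) (hN₂ : DeJong1996NodeLocalStructureCodimTwo.{u})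
    (hK : DeJong1996SemiStableCodimTwoBlowupCore.{u}) (hS : DeJong1996NodalBlowupSingularLocus.{u}) :
    DeJong1996SemiStablePairResolution.{u} :=
  DeJong1996SemiStablePairResolution.of_normalForm
    (DeJong1996SemiStablePairNormalForm.of_printedLeaves hN hN₂ hK)
    (DeJong1996NormalFormPairResolution.of_liveLeaves DeJong1996NormalFormPairCentreFormalIdeal_holds
      hS DeJong1996NormalFormPairCentreIntersection_holds StrictTransformClosedImmersion_holds
      DeJong1996NormalFormPairBlowupChartsOverCentre_holds DeJong1996FormalNormalCrossings_holds
      DeJong1996NormalCrossingsBlowup_holds BlowupProjectiveOverField_holds)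

/-- **4.11–4.12 from its six open leaves** (de Jong 1996, fibring a normal projective pair in
curves over `ℙ^d`): as `DeJong1996FibrationReduction.of_printedLeaves`, with 2.8 ("one smooth
fibre ⇒ smooth over a non-empty open", `DeJong1996SmoothOverOpen_holds`) discharged.
[cite: DeJong1996, Lemma 4.11 and 4.12, pp. 67–69] -/
theorem DeJong1996FibrationReduction.of_openLeaves
    (hV : DeJong1996VertexBlowupProjection.{u}) (hC : DeJong1996Lemma411VertexChoice.{u})
    (hZ : steinFactorization_geometricallyConnected.{u}) (hE : DeJong1996SteinFactorizationEtale.{u})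
    (hP1 : ProjectiveLineSimplyConnected.{u}) (hH : EtaleCoverHyperplaneSectionConnected.{u}) :
    DeJong1996FibrationReduction.{u} :=
  DeJong1996FibrationReduction.of_printedLeaves hV hC DeJong1996SmoothOverOpen_holds hZ hE hP1 hH

/-- **`DeJong1996NormalProjectiveStep` — de Jong 1996, 4.11–4.28 — from the fourteen named facts
currently open below it** (module docstring); its discharge is this term applied to their
discharges, through `DeJong1996NormalProjectiveStep.of_threeBlocks`.
[cite: DeJong1996, 4.11–4.28, pp. 67–76] -/
theorem DeJong1996NormalProjectiveStep.of_openLeaves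
    -- 4.11–4.12
    (hV : DeJong1996VertexBlowupProjection.{u}) (hC : DeJong1996Lemma411VertexChoice.{u})
    (hZ : steinFactorization_geometricallyConnected.{u}) (hE : DeJong1996SteinFactorizationEtale.{u})
    (hP1 : ProjectiveLineSimplyConnected.{u}) (hH : EtaleCoverHyperplaneSectionConnected.{u})
    -- 4.13–4.22
    (h13 : DeJong1996MultisectionHyperplane.{u}) (h16 : DeJong1996GaloisNormalization.{u})
    (h17 : DeJong1996StableExtension.{u}) (h18 : DeJong1996RationalMapExtension.{u})
    -- 4.23–4.28
    (hN : DeJong1996NodeLocalStructure.{u}) (hN₂ : DeJong1996NodeLocalStructureCodimTwo.{u})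
    (hK : DeJong1996SemiStableCodimTwoBlowupCore.{u}) (hS : DeJong1996NodalBlowupSingularLocus.{u}) :
    DeJong1996NormalProjectiveStep.{u} :=
  DeJong1996NormalProjectiveStep.of_threeBlocks
    (DeJong1996FibrationReduction.of_openLeaves hV hC hZ hE hP1 hH)
    (DeJong1996FibrationToSemiStablePair.of_printedLeaves h13 h16 h17 h18)
    (DeJong1996SemiStablePairResolution.of_openLeaves hN hN₂ hK hS)

/-- The same fourteen leaves give Thm. 4.1 with its generically-étale clause over algebraically
closed fields (4.3, 4.4, 4.6–4.10 and the induction being proved: `DeJong1996StrongAlgClosed.of_step`).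
[cite: DeJong1996, Thm. 4.1 and 4.3–4.28, pp. 66–76] -/
theorem DeJong1996StrongAlgClosed.of_openLeaves
    (hV : DeJong1996VertexBlowupProjection.{u}) (hC : DeJong1996Lemma411VertexChoice.{u})
    (hZ : steinFactorization_geometricallyConnected.{u}) (hE : DeJong1996SteinFactorizationEtale.{u})
    (hP1 : ProjectiveLineSimplyConnected.{u}) (hH : EtaleCoverHyperplaneSectionConnected.{u})
    (h13 : DeJong1996MultisectionHyperplane.{u}) (h16 : DeJong1996GaloisNormalization.{u})
    (h17 : DeJong1996StableExtension.{u}) (h18 : DeJong1996RationalMapExtension.{u})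
    (hN : DeJong1996NodeLocalStructure.{u}) (hN₂ : DeJong1996NodeLocalStructureCodimTwo.{u})
    (hK : DeJong1996SemiStableCodimTwoBlowupCore.{u}) (hS : DeJong1996NodalBlowupSingularLocus.{u}) :
    DeJong1996StrongAlgClosed.{u} :=
  DeJong1996StrongAlgClosed.of_step
    (DeJong1996NormalProjectiveStep.of_openLeaves hV hC hZ hE hP1 hH h13 h16 h17 h18 hN hN₂ hK hS)

/-- … and Thm. 4.1 (i)+(ii) over every field, its last sentence over perfect fields
(`DeJong1996Descent_holds`, 4.5), conclusion (i) alone (`DeJong1996Projective`) and the weak form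
`DeJong1996`. [cite: DeJong1996, Thm. 4.1, p. 66] -/
theorem DeJong1996Strong.of_openLeaves
    (hV : DeJong1996VertexBlowupProjection.{u}) (hC : DeJong1996Lemma411VertexChoice.{u})
    (hZ : steinFactorization_geometricallyConnected.{u}) (hE : DeJong1996SteinFactorizationEtale.{u})
    (hP1 : ProjectiveLineSimplyConnected.{u}) (hH : EtaleCoverHyperplaneSectionConnected.{u})
    (h13 : DeJong1996MultisectionHyperplane.{u}) (h16 : DeJong1996GaloisNormalization.{u})
    (h17 : DeJong1996StableExtension.{u}) (h18 : DeJong1996RationalMapExtension.{u})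
    (hN : DeJong1996NodeLocalStructure.{u}) (hN₂ : DeJong1996NodeLocalStructureCodimTwo.{u})
    (hK : DeJong1996SemiStableCodimTwoBlowupCore.{u}) (hS : DeJong1996NodalBlowupSingularLocus.{u}) :
    DeJong1996Strong.{u} ∧ DeJong1996StrongPerfect.{u} ∧ DeJong1996Projective.{u} ∧ DeJong1996.{u} :=
  have h := DeJong1996Descent_holds
    (DeJong1996StrongAlgClosed.of_openLeaves hV hC hZ hE hP1 hH h13 h16 h17 h18 hN hN₂ hK hS)
  ⟨h.1, h.2, h.1.projective, h.1.deJong1996⟩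

end Literature.AlgebraicGeometry.Resolution

end
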